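import Summits.Parity.GeneralizedHardyLittlewood.Theorems.BeyondDiagonalBeatsQuarter.OffDiagHeartNear
import HarnessLib

/-!
# Route `PrimeLevelFamEdge`, crux K_B (stmt-Parity-20343), line `diagonal_kernel_split` rev 4, plan Ω,
# sub-line **Ω-h (v4, shape) — the FINITE DUAL CORE: near head with the dual modulus truncated to `|h₁| ≤ H`, the
# second frequency kept COMPLETE; heart ⇐ (truncation costs ≤ ε·ms) ∧ (block bound for the core at clean scales)**

Ω-h v3 (`OffDiagHeartNear`, p640410) reduced the heart to a block bound for `offDiagNearHead` = a finite sum (r < q⁷, l, m,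
d₁∣l, d₂∣m, i ∈ nearBoxes) of COMPLETE dual series `Σ_{h∈ℤ²} Φ̂_i(h/(q(r+1)))·N`. prover-2's L2 (`OffDiagDualTruncationBound.
tsum_tail_norm_fourier2_mul_le_of_cost`) bounds the tail `|h₁| > H` of such a series by `2S(1+c²E/12)·H·Q^{−k}·N₀` once the
derivative costs `A_k ≤ S·D^k`, `B_k ≤ S·D^k·E` of the box weight are known (L2c P6/P7, in flight). This file fixes the SHAPE
of the resulting core and the glue, so that P8 only has to prove the displayed truncation estimate:

* `offDiagCore Hf Δ′ q` (definition, reviewed): the near head with each dual series restricted to `|h₁| ≤ Hf q d₁ d₂ α β c i`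
  (`h₂ ∈ ℤ` complete — the divisor switch `OffDiagDivisorSwitchSeries` and the principal-part completion lemmas want exactly that);
* **`offDiagBelowSlack_io_of_coreBlockAtCleanScales(_a₀)`** — for ANY height function `Hf`: if
  (T) `∀ Δ′∈(1,2) ∀ε>0 ∃q₀ ∀ prime q ≥ q₀: |offDiagNearHead Δ′ q − offDiagCore Hf Δ′ q| ≤ ε·ms` (P8's target) and
  (Ω) the block bound `Σ_{q∈goodPrimes} offDiagCore Hf Δ′ q ≤ U·Σ ms` at clean scales (p634449's shells),
  then `stub_offDiagBelowSlack_io` holds VERBATIM (triangle inequality + Ω-h v1).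

Bookkeeping; standard axioms. Helper; closes nothing (both (T) for a concrete `Hf` and (Ω) are open: (T) mechanical = L2c P6–P8,
(Ω) = LIVE-Ω proper).
«The programme SEARCHES and TYPES; no claim about Landau–Siegel zeros, Theorems 1–2 of arXiv:2211.02515 or
a repaired Margin232 until a kernel theorem says so.»
-/

noncomputable section

open Finset Polynomial
open scoped Real FourierTransform

namespace Summit.Parity.GeneralizedHardyLittlewood.Theorems.BeyondDiagonalBeatsQuarter.OffDiag

open Literature.NumberTheory.LFunctions Literature.NumberTheory.LFunctions.KMV2000
open Literature.NumberTheory.Sieve.FriedlanderIwaniecPrimes (fourier2)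
open PeterssonSplit (offDiag offDiagMollified nearBoxes)

/-- **The finite dual core** of the mollified off-diagonal, for a height function `Hf` (dual-modulus truncation
`|h₁| ≤ Hf q d₁ d₂ α β c i`, second frequency complete):
`−re(2q̂(2π/q)·Σ_{r<q⁷} Σ_{l,m} c_l c_m·Σ_{d₁∣l,d₂∣m} Σ_{i∈nearBoxes} Σ_{h∈ℤ², |h₁| ≤ Hf…} Φ̂_i(h/(q(r+1)))·N_{q(r+1)}(l/d₁,m/d₂;h))`.
[cite: KowalskiMichelVanderKam2000, §6 p. 19, (21)–(23) p. 12; KowalskiMichel2000, §2.4.2 p. 312 — derivation] -/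
def offDiagCore (Hf : ℕ → ℕ → ℕ → ℕ → ℕ → ℕ → ℕ × ℕ → ℕ) (Δ' : ℝ) (q : ℕ) : ℝ :=
  if hq : q = 0 then 0 else
    (haveI : NeZero q := ⟨hq⟩;
      -(2 * (qhat q : ℂ) * (2 * π / q) *
          ∑ r ∈ Finset.range (q ^ 7), ∑ l ∈ Icc 1 ⌊qhat q ^ Δ'⌋₊, ∑ m ∈ Icc 1 ⌊qhat q ^ Δ'⌋₊,
            ((mollifierCoeff (X ^ 2) (qhat q ^ Δ') l * mollifierCoeff (X ^ 2) (qhat q ^ Δ') m : ℝ) : ℂ) *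
              ∑ d₁ ∈ l.divisors, ∑ d₂ ∈ m.divisors, ∑ i ∈ nearBoxes q d₁ d₂ (Real.log q ^ 4),
                ∑' h : ℤ × ℤ,
                  (if |h.1| ≤ (Hf q d₁ d₂ (l / d₁) (m / d₂) (r + 1) i : ℤ) then
                    fourier2 (boxWeight q d₁ d₂ (l / d₁) (m / d₂) (r + 1) i)
                        (h.1 / (q * (r + 1) : ℕ)) (h.2 / (q * (r + 1) : ℕ)) *
                      (dualCount (q * (r + 1)) ((l / d₁ : ℕ) : ZMod (q * (r + 1))) ((m / d₂ : ℕ) : ZMod (q * (r + 1)))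
                        (h.1 : ZMod (q * (r + 1))) (h.2 : ZMod (q * (r + 1))) : ℂ)
                  else 0)).re)

/-- **Triangle step**: an `ε·ms`-truncation estimate (T) on top of Ω-h v3's near-head approximation makes the core an
`ε·ms`-approximant of `offDiagMollified` (for `Δ′ ∈ (1,2)`). [folklore] -/
theorem abs_offDiagMollified_sub_offDiagCore_le (Hf : ℕ → ℕ → ℕ → ℕ → ℕ → ℕ → ℕ × ℕ → ℕ)
    (hT : ∀ Δ' : ℝ, 1 < Δ' → Δ' < 2 → ∀ ε : ℝ, 0 < ε → ∃ q₀ : ℕ, ∀ q : ℕ, q₀ ≤ q → q.Prime →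
      |offDiagNearHead Δ' q - offDiagCore Hf Δ' q| ≤ ε * mainScaleReal Δ' q)
    {Δ' : ℝ} (h1 : 1 < Δ') (h2 : Δ' < 2) {ε : ℝ} (hε : 0 < ε) :
    ∃ q₀ : ℕ, ∀ q : ℕ, q₀ ≤ q → q.Prime → |offDiagMollified Δ' q - offDiagCore Hf Δ' q| ≤ ε * mainScaleReal Δ' q := by
  have hε2 : 0 < ε / 2 := by linarith
  obtain ⟨q₁, hq₁⟩ := abs_offDiagMollified_sub_offDiagNearHead_le hε2
  obtain ⟨q₂, hq₂⟩ := hT Δ' h1 h2 (ε / 2) hε2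
  refine ⟨max q₁ q₂, fun q hq hp ↦ ?_⟩
  have ha := hq₁ q (le_trans (le_max_left _ _) hq) hp Δ' (lt_trans zero_lt_one h1) h2.le
  have hb := hq₂ q (le_trans (le_max_right _ _) hq) hp
  calc |offDiagMollified Δ' q - offDiagCore Hf Δ' q|
      = |(offDiagMollified Δ' q - offDiagNearHead Δ' q) + (offDiagNearHead Δ' q - offDiagCore Hf Δ' q)| := by ring_nf
    _ ≤ |offDiagMollified Δ' q - offDiagNearHead Δ' q| + |offDiagNearHead Δ' q - offDiagCore Hf Δ' q| := abs_add_le _ _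
    _ ≤ ε / 2 * mainScaleReal Δ' q + ε / 2 * mainScaleReal Δ' q := add_le_add ha hb
    _ = ε * mainScaleReal Δ' q := by ring

/-- **Ω-h (v4): the heart from (T) a dual-truncation estimate and (Ω) a block bound for the FINITE DUAL CORE at clean
scales** (`c′₀`-first shell). [cite: MontgomeryVaughan2007, Cor. 11.10 (Page); KowalskiMichelVanderKam2000, §6 p. 19 — derivation] -/
theorem offDiagBelowSlack_io_of_coreBlockAtCleanScales (Hf : ℕ → ℕ → ℕ → ℕ → ℕ → ℕ → ℕ × ℕ → ℕ)
    (hT : ∀ Δ' : ℝ, 1 < Δ' → Δ' < 2 → ∀ ε : ℝ, 0 < ε → ∃ q₀ : ℕ, ∀ q : ℕ, q₀ ≤ q → q.Prime →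
      |offDiagNearHead Δ' q - offDiagCore Hf Δ' q| ≤ ε * mainScaleReal Δ' q)
    (hΩ : ∀ c₀' : ℝ, 0 < c₀' → ∃ b : ℝ, 1 < b ∧ ∀ Δ' : ℝ, 1 < Δ' → Δ' < b →
      ∃ U : ℝ, U < 4 * (Δ' - 1) / Δ' ∧ ∃ a₀ : ℝ, 0 < a₀ ∧ ∃ η' : ℝ, 0 < η' ∧ η' < c₀' / a₀ ∧
        ∃ N₀ : ℕ, ∀ N : ℕ, N₀ ≤ N → CleanScale a₀ η' N →
          ∑ q ∈ goodPrimes Δ' N, offDiagCore Hf Δ' q ≤ U * ∑ q ∈ goodPrimes Δ' N, mainScaleReal Δ' q) :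
    ∃ b : ℝ, 1 < b ∧ ∀ Δ' : ℝ, 1 < Δ' → Δ' < b → ∃ U : ℝ, U < 4 * (Δ' - 1) / Δ' ∧
      ∀ q₀ : ℕ, ∃ q : ℕ, ∃ _ : NeZero q, q₀ ≤ q ∧ q.Prime ∧
        (∀ n : ℕ, (n : ℝ) ≠ qhat q ^ Δ') ∧
          -(∑ l ∈ Icc 1 ⌊qhat q ^ Δ'⌋₊, ∑ m ∈ Icc 1 ⌊qhat q ^ Δ'⌋₊,
              ((mollifierCoeff (X ^ 2) (qhat q ^ Δ') l * mollifierCoeff (X ^ 2) (qhat q ^ Δ') m : ℝ) : ℂ) *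
                offDiag q l m).re ≤ U * mainScaleReal Δ' q :=
  offDiagBelowSlack_io_of_approxBlockAtCleanScales (offDiagCore Hf)
    (fun _ h1 h2 _ hε ↦ abs_offDiagMollified_sub_offDiagCore_le Hf hT h1 h2 hε) hΩ

/-- The same in the `a₀`-first shell. [cite: MontgomeryVaughan2007, Cor. 11.10 (Page); KowalskiMichelVanderKam2000, §6 p. 19 — derivation] -/
theorem offDiagBelowSlack_io_of_coreBlockAtCleanScales_a₀ (Hf : ℕ → ℕ → ℕ → ℕ → ℕ → ℕ → ℕ × ℕ → ℕ)
    (hT : ∀ Δ' : ℝ, 1 < Δ' → Δ' < 2 → ∀ ε : ℝ, 0 < ε → ∃ q₀ : ℕ, ∀ q : ℕ, q₀ ≤ q → q.Prime →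
      |offDiagNearHead Δ' q - offDiagCore Hf Δ' q| ≤ ε * mainScaleReal Δ' q)
    (hΩ : ∃ a₀ : ℝ, 0 < a₀ ∧ ∀ η₀ : ℝ, 0 < η₀ → ∃ b : ℝ, 1 < b ∧ ∀ Δ' : ℝ, 1 < Δ' → Δ' < b →
      ∃ U : ℝ, U < 4 * (Δ' - 1) / Δ' ∧ ∃ η' : ℝ, 0 < η' ∧ η' < η₀ ∧ ∃ N₀ : ℕ, ∀ N : ℕ, N₀ ≤ N →
        CleanScale a₀ η' N →
          ∑ q ∈ goodPrimes Δ' N, offDiagCore Hf Δ' q ≤ U * ∑ q ∈ goodPrimes Δ' N, mainScaleReal Δ' q) :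
    ∃ b : ℝ, 1 < b ∧ ∀ Δ' : ℝ, 1 < Δ' → Δ' < b → ∃ U : ℝ, U < 4 * (Δ' - 1) / Δ' ∧
      ∀ q₀ : ℕ, ∃ q : ℕ, ∃ _ : NeZero q, q₀ ≤ q ∧ q.Prime ∧
        (∀ n : ℕ, (n : ℝ) ≠ qhat q ^ Δ') ∧
          -(∑ l ∈ Icc 1 ⌊qhat q ^ Δ'⌋₊, ∑ m ∈ Icc 1 ⌊qhat q ^ Δ'⌋₊,
              ((mollifierCoeff (X ^ 2) (qhat q ^ Δ') l * mollifierCoeff (X ^ 2) (qhat q ^ Δ') m : ℝ) : ℂ) *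
                offDiag q l m).re ≤ U * mainScaleReal Δ' q :=
  offDiagBelowSlack_io_of_approxBlockAtCleanScales_a₀ (offDiagCore Hf)
    (fun _ h1 h2 _ hε ↦ abs_offDiagMollified_sub_offDiagCore_le Hf hT h1 h2 hε) hΩ

end Summit.Parity.GeneralizedHardyLittlewood.Theorems.BeyondDiagonalBeatsQuarter.OffDiag
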